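import Summits.Parity.GeneralizedHardyLittlewood.Theorems.PrimeLevelFamEdgeMomentsBeyondDiagonalTwoOrderDictionary
import HarnessLib

/-!
# Route `PrimeLevelFamEdge`, crux K_A `MomentsBeyondDiagonal` (stmt-Parity-20007), line «petersson_layers» v4:
# the dictionary at every `Q` WITH PETERSSON'S FORMULA SUBSTITUTED — `Q^h(P,Q)(M)` de-automorphised

General-`Q` analogue of `QhPQ_one_eq_tsum_delta_sub_petJ` (`…DictionaryAtOne`, p630383): in the two-order dictionary
`QhPQ_eq_sum_orders_tsum_pet` (`…TwoOrderDictionary`) every inner pair average `Σʰ λ_f(a)λ_f(b)` (`a = m₁n₁/d₁²`,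
`b = m₂n₂/d₂² ≥ 1`) is `δ(a,b) − J(a,b)` by the tree's THEOREM `KowalskiMichel2000.kowalskiMichel2000_peterssonFormula_holds`
(`J(a,b) = petJ q a b = (2π/q) Σ_{r≥1} r⁻¹ S(a,b;qr) J₁(4π√(ab)/(qr))`). After this step NO automorphic object remains in
`Q^h(P,Q)(M)` for ANY real polynomial `Q`: an explicit series of Kloosterman sums, Bessel values, Möbius coefficients and the
two-order weights `W_{ij}` — the object deck 21a's `spectralSum` truncates to the AFE box. Proof only; K_A NOT proved; nothing
about Landau–Siegel zeros.
-/

noncomputable section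

open scoped Real
open Complex Finset Polynomial CongruenceSubgroup
open Literature.NumberTheory.EllipticCurves.ModularForms
open Literature.NumberTheory.LFunctions

namespace Summit.Parity.GeneralizedHardyLittlewood.Theorems.MomentsBeyondDiagonal.TwoOrderAFE

open Summit.Parity.GeneralizedHardyLittlewood.Theorems.PrimeLevelFamEdgeIdeaDeltas.PeterssonLayers (diagKernel)

/-- For `d ∈ divisors (gcd m n)` with `m ≥ 1`, `n ≠ 0`: `1 ≤ m n / d²`. -/
theorem one_le_mul_div_sq {m n d : ℕ} (hm : 1 ≤ m) (hn : n ≠ 0) (hd : d ∈ (Nat.gcd m n).divisors) :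
    1 ≤ m * n / d ^ 2 := by
  have hdv : d ∣ Nat.gcd m n := Nat.dvd_of_mem_divisors hd
  have hdd : d ^ 2 ∣ m * n := by
    rw [sq]; exact Nat.mul_dvd_mul (hdv.trans (Nat.gcd_dvd_left _ _)) (hdv.trans (Nat.gcd_dvd_right _ _))
  have hpos : 0 < m * n := Nat.mul_pos (by omega) (Nat.pos_of_ne_zero hn)
  exact Nat.div_pos (Nat.le_of_dvd hpos hdd) (Nat.pos_of_mem_divisors hd |> fun h ↦ by positivity)

/-- **The two-order dictionary with Petersson's formula substituted** (every `Q`; `q` prime, `⌊M⌋ < q`):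
`Q^h(P,Q)(M) = Σ_{i,j ≤ deg Q} QᵢQⱼ ℓ^{−(i+j)} Σ'_{(n₁,n₂)} (1+(−1)^{i+j}) q̂ (n₁n₂)^{−1/2} W_{ij}(q̂;n₁,n₂) Σ_{m₁,m₂ ≤ M} x_{m₁}x_{m₂}
Σ_{d₁∣(m₁,n₁)} Σ_{d₂∣(m₂,n₂)} [δ(a,b) − J(a,b)]`, `a = m₁n₁/d₁²`, `b = m₂n₂/d₂²`.
[cite: KowalskiMichel2000, §2.4.2 p. 312 (Petersson's formula with its Kloosterman–Bessel series)] -/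
theorem QhPQ_eq_sum_orders_tsum_delta_sub_petJ {q : ℕ} [NeZero q] (hq : q.Prime) (P Q : ℝ[X]) {M : ℝ}
    (hM : ⌊M⌋₊ < q) :
    KMV2000.QhPQ q P Q M =
      ∑ i ∈ range (Q.natDegree + 1), ∑ j ∈ range (Q.natDegree + 1),
        (Q.coeff i : ℂ) * (Q.coeff j : ℂ) * (((Real.log (KMV2000.qhat q))⁻¹ : ℝ) : ℂ) ^ (i + j) *
        ∑' n : ℕ × ℕ, (1 + (-1 : ℂ) ^ (i + j)) * (KMV2000.qhat q : ℂ) *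
          (((((n.1 : ℝ) * n.2) ^ (-(1 / 2 : ℝ)) : ℝ) : ℂ) * KMV2000.afeW (KMV2000.qhat q) i j n.1 n.2 *
          ∑ m₁ ∈ Icc 1 ⌊M⌋₊, ∑ m₂ ∈ Icc 1 ⌊M⌋₊,
            (KMV2000.mollifierCoeff P M m₁ : ℂ) * (KMV2000.mollifierCoeff P M m₂ : ℂ) *
            ∑ d₁ ∈ (Nat.gcd m₁ n.1).divisors, ∑ d₂ ∈ (Nat.gcd m₂ n.2).divisors,
              (diagKernel (m₁ * n.1 / d₁ ^ 2) (m₂ * n.2 / d₂ ^ 2) -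
                KowalskiMichel2000.petJ q (m₁ * n.1 / d₁ ^ 2) (m₂ * n.2 / d₂ ^ 2))) := by
  rw [QhPQ_eq_sum_orders_tsum_pet hq P Q hM]
  refine Finset.sum_congr rfl fun i _ ↦ ?_
  refine Finset.sum_congr rfl fun j _ ↦ ?_
  refine congrArg (HMul.hMul _) ?_
  refine tsum_congr fun n ↦ ?_
  by_cases h0 : n.1 = 0 ∨ n.2 = 0
  · have hz : ((n.1 : ℝ) * n.2) = 0 := by rcases h0 with h | h <;> simp [h]
    rw [hz, Real.zero_rpow (by norm_num)]
    simp
  · rw [not_or] at h0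
    refine congrArg (HMul.hMul _) (congrArg (HMul.hMul _) ?_)
    refine Finset.sum_congr rfl fun m₁ hm₁ ↦ ?_
    refine Finset.sum_congr rfl fun m₂ hm₂ ↦ ?_
    rw [Finset.mem_Icc] at hm₁ hm₂
    refine congrArg (HMul.hMul _) ?_
    refine Finset.sum_congr rfl fun d₁ hd₁ ↦ ?_
    refine Finset.sum_congr rfl fun d₂ hd₂ ↦ ?_
    rw [(KowalskiMichel2000.kowalskiMichel2000_peterssonFormula_holds q hq _ _
      (one_le_mul_div_sq hm₁.1 h0.1 hd₁) (one_le_mul_div_sq hm₂.1 h0.2 hd₂)).2, diagKernel]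

end Summit.Parity.GeneralizedHardyLittlewood.Theorems.MomentsBeyondDiagonal.TwoOrderAFE

end
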